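import Summits.QuantumFields.YangMills.Theorems.BalabanUVNodesN15CurvedDressedPairDefectExp
import Summits.QuantumFields.YangMills.Theorems.BalabanUVNodesN15CurvedGeneratorFitsTorus
import HarnessLib

/-!
# Route «BalabanUVNodes» (cluster K4 «SpineRates»), Track-A DAG node N15 = NE2, BACKGROUND LAYER — THE CURVED KNIT ON KING's TORUS PAIRING: NE2⁺ (entries 0∕1, block-defect form)
# PROPAGATES FROM `U` TO `e^{η′Z′}·U` UNDER (3.35)∕(3.36)-SHAPED LETTERS ON THE FINE GENERATOR FIELDS ALONE — file 7's `hasMaj_idef_curvDressed_exp_of_skew` on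
# `blockOf L M : Tor (fine L M) → Tor M`, unit translations, `η = Lη′`, the coarse generators the BLOCK MEANS of the fine ones (linearised transport), every generator-level
# fit∕letter of the knit DISCHARGED by files 8–9

Cell `pub-ymgap`, seat `pub-ymgap-dag-n15-w3` (WIDTH SEAT 3∕3 on node N15, director-ym №197 ∕ HUMAN RULING D-0149; plan `W-SEAT-START-LIST.md` §n15 item 3 — tenth piece, the
END of the curved line at generator level).  `bears_on: R4∕N15 · K3⁷ SpineGivenEndpointR13SepCoPH (stmt-QuantumFields-20544)`.  Filed `--kind proof --supports stmt-QuantumFields-20544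
--as helper` — COUNT-NEUTRAL.  Imports BY NAME this seat's file 7 `…N15CurvedDressedPairDefectExp` (`hasMaj_idef_curvDressed_exp_of_skew`, `fitTranslated_of_fit_of_compat`,
`expRowLetter`, `expFitLetter`) and file 9 `…N15CurvedGeneratorFitsTorus` (`blockMeanTV`, `blockOf_compat_addRight`, `fit_blockMeanTV`, `norm_blockMeanTV_le`, `fit_bdiffTV_blockMeanTV`,
`norm_fdiffTV_blockMeanTV_le`; through it dag-n15-b 12d and [Lit] King's torus carrier `Tor`, `fine`, `site`, `blockOf`, n15-a `unitVec`, and `coeff_osc_rate`∕`species2_rate`); nothing in the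
tree is modified.

WHY.  Files 1–7 built Bałaban's (3.52)–(3.65) at a CURVED base point on abstract finite carriers and knitted them into ONE theorem whose non-inductive data are generator-level
letters∕fits; files 8–9 proved those fits on `ℤ^d` and on King's finite torus pairing at the linearised transport.  THIS FILE plugs 9 into 7: on the torus pairing the coarse
perturbation∕background generators are `Z := blockMeanTV Z′`, `W := blockMeanTV W′`, the steps are the unit translations, `π = blockOf L M`, `η = L·η′`; then the knit's
hypotheses `hZ, hW` (sizes: `norm_blockMeanTV_le`), `hgrad` (coarse gradient letter: `norm_fdiffTV_blockMeanTV_le`), `hfit` (plain fit: `fit_blockMeanTV` at `θ₁ = η′g` + `coeff_osc_rate`,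
`o = d·η·g`), `hfitT`∕`hfitW` (translated fits: `fitTranslated_of_fit_of_compat` + `blockOf_compat_addRight`, `o_t = o + ηg`), `hfitD` (derivative fit: `fit_bdiffTV_blockMeanTV` at
`θ₂ = η′G₂` + `species2_rate`, `o_D = (d+1)·η·G₂`) and the skewness of the coarse generators (`blockMeanTV_skew`: block means of skew generators are skew) are THEOREMS, leaving:
the [B6] carrier on `Tor M`, the (3.42)₀,₁-shaped block majorants AND η-defects of `G(U)`, `D^±_RG(U)` (the inductive datum), the Neumann smallness, the regimes, and
(3.35)∕(3.36)-SHAPED LETTERS ON THE FINE GENERATOR FIELDS: `‖Z′‖ ≤ r`, `‖W′‖ ≤ r_B`, `‖Z′_μ(y′) − Z′_μ(y′ − e_ν)‖ ≤ η′g`, `‖W′_μ(y′) − W′_μ(y′ − e_ν)‖ ≤ η′g_B` (all `μ, ν`), the second-difference letter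
`‖η′⁻¹(Z′_μ(z′ + e_ν) − Z′_μ(z′ + e_ν − e_μ)) − …‖`-type bound `η′G₂`, and skewness of `coordMat e (Z′_μ y′)`, `coordMat e (W′_μ y′)` ([Balaban1985BackgroundPropagators] (3.35)–(3.37) p. 396:
*«|A| < O(1)Mα₀(L^jη)^{−1}, |∇^ηA| < O(1)Mα₀(L^jη)^{−2} … |∂^{η*}∂^ηA| < O(1)Mα₀(L^jη)^{−3} … U′ = e^{iηA′}»* = SHAPES).

* §1 `torStep` (the unit translations as steps `Tor N ≃ Tor N`), `torStep_symm_apply`; `blockMeanField`; `coordMat_blockMeanTV`, ★ `blockMeanTV_skew`; `quotient_le_of_gradLetter`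
  (`‖Z′(y′) − Z′(y′ − e)‖ ≤ η′g ⟹ ‖η′⁻¹(Z′(w + e) − Z′(w))‖ ≤ g`), `gradLetter_blockMean` (the coarse gradient letter `≤ ηg`, `η = Lη′`);
* §2 ★★★ `hasMaj_idef_curvDressed_kingTorus` — THE END-TO-END STATEMENT of the curved line at generator level on King's pairing.

HONEST FRAMING ∕ LIMITS.  A plug (no new estimate) over files 7–9 and dag-n15-b 12a∕12b∕12d; LINEARISED transport (the coarse generator is the block mean — Bałaban's (C3) n-fold
average and its NE3-type fit are NOT touched); flat unit translations on the tori; crude constants; the inductive datum (majorants∕defects of `G(U)` at the curved `U`), the carrier and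
the smallness stay displayed; base case `U ≡ 1` = dag-n15-c's layer; [B6] gluing untouched; nothing of [B9] asserted.  NE2⁺ NOT PRINTED, NOT proved; N15 NOT discharged; counts of record
UNMOVED (typed 28∕28 · discharged 5∕27); finite tori at fixed ε — NOT infinite volume, NOT OS on ℝ⁴, NOT a mass gap, NOT Clay; R4 closes the conditional finite-𝕋⁴ rung `BalabanLadder.UV`
only.  Restate-immune (no Theses import).
-/

set_option autoImplicit false

noncomputable section
open scoped BigOperators Matrix
open Finset NormedSpace

namespace Summit.QuantumFields.YangMills.BalabanUVNodes.N15.CurvedSpecies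

open Literature.MathematicalPhysics.QuantumFieldTheory.Balaban1983to89
open Literature.MathematicalPhysics.QuantumFieldTheory.Balaban1983to89.B11SectG (BlockNorm HasMaj RowSum)
open Literature.MathematicalPhysics.QuantumFieldTheory.Balaban1983to89.T4EtaRateDefect (idef)
open Literature.MathematicalPhysics.QuantumFieldTheory.Balaban1983to89.T4EtaRateCoeffDefect (pull coeff_osc_rate)
open Literature.MathematicalPhysics.QuantumFieldTheory.Balaban1983to89.B6RandomWalk (Triangle254)
open Literature.MathematicalPhysics.QuantumFieldTheory.Balaban1983to89.B5Prop11Plancherel (Tor fine)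
open Literature.MathematicalPhysics.QuantumFieldTheory.King1986.Torus (site blockOf)
open Summit.QuantumFields.YangMills.BalabanUVNodes.N15.MatrixSpecies (liftMap liftBlk coordMat basisConst basisConst_nonneg)
open Summit.QuantumFields.YangMills.BalabanUVNodes.N15.BackgroundLayer (liftPair blkPair coordMat_smul coordMat_sum)
open Summit.QuantumFields.YangMills.BalabanUVNodes.N15.KingTorusLine (unitVec)
open Summit.QuantumFields.YangMills.BalabanUVNodes.N15.CoefficientSpecies (species2_rate)

variable {d : ℕ}

/-! ## §1 Steps, block-mean fields, skewness of block means, quotient letters -/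

section Prelim

/-- THE UNIT TRANSLATIONS of a multi-period torus as the knit's steps `τ_μ : X ≃ X` (`τ_μ y = y + e_μ`). [folklore] -/
def torStep (N : Fin d → ℕ) (μ : Fin d) : Tor N ≃ Tor N := Equiv.addRight (unitVec N μ)

/-- One step back: `(τ_μ)⁻¹ y = y − e_μ`. [folklore] -/
@[simp] theorem torStep_symm_apply (N : Fin d → ℕ) (μ : Fin d) (y : Tor N) : (torStep N μ).symm y = y - unitVec N μ := by
  simp only [torStep, Equiv.addRight_symm, Equiv.coe_addRight, ← sub_eq_add_neg]

variable (L : ℕ) [NeZero L] (M : Fin d → ℕ) [hM : ∀ μ, NeZero (M μ)]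
variable {V : Type} [NormedAddCommGroup V] [NormedSpace ℝ V]

/-- THE COARSE GENERATOR FIELD = the block means of the fine one, direction by direction (LINEARISED transport). [folklore] -/
def blockMeanField (Z' : Fin d → Tor (fine L M) → V) : Fin d → Tor M → V := fun μ b => blockMeanTV L M (Z' μ) b

variable {ι : Type} [Fintype ι] [DecidableEq ι] {𝔄 : Type} [NormedRing 𝔄] [NormedAlgebra ℝ 𝔄] (e : 𝔄 ≃L[ℝ] (ι → ℝ))

omit [NeZero L] hM in
/-- Coordinates of a block mean are the block mean of the coordinates (coordinates are linear). [folklore] -/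
theorem coordMat_blockMeanTV (a' : Tor (fine L M) → (𝔄 →L[ℝ] 𝔄)) (b : Tor M) :
    coordMat e (blockMeanTV L M a' b) = ((L : ℝ) ^ d)⁻¹ • ∑ j : Fin d → Fin L, coordMat e (a' (site L M b j)) := by
  rw [blockMeanTV, coordMat_smul, coordMat_sum]

omit [NeZero L] hM in
/-- ★ BLOCK MEANS OF SKEW GENERATORS ARE SKEW (transposition is linear). [folklore] -/
theorem blockMeanTV_skew {a' : Tor (fine L M) → (𝔄 →L[ℝ] 𝔄)} (h : ∀ y', (coordMat e (a' y'))ᵀ = -coordMat e (a' y')) (b : Tor M) :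
    (coordMat e (blockMeanTV L M a' b))ᵀ = -coordMat e (blockMeanTV L M a' b) := by
  rw [coordMat_blockMeanTV, Matrix.transpose_smul, Matrix.transpose_sum, ← smul_neg, ← Finset.sum_neg_distrib]
  congr 1
  exact Finset.sum_congr rfl fun j _ => h _

omit [NeZero L] hM in
/-- FROM THE GRADIENT LETTER TO THE QUOTIENT LETTER: `‖a(y) − a(y − e_μ)‖ ≤ η′g` everywhere (`0 < η′`) ⟹ `‖η′⁻¹(a(w + e_μ) − a(w))‖ ≤ g`. [folklore] -/
theorem quotient_le_of_gradLetter {N : Fin d → ℕ} {η' g : ℝ} (hη' : 0 < η') {a : Tor N → V} (μ : Fin d) (h : ∀ y, ‖a y - a (y - unitVec N μ)‖ ≤ η' * g)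
    (w : Tor N) : ‖η'⁻¹ • (a (w + unitVec N μ) - a w)‖ ≤ g := by
  have h1 := h (w + unitVec N μ)
  rw [add_sub_cancel_right] at h1
  rw [norm_smul, norm_inv, Real.norm_eq_abs, abs_of_pos hη', inv_mul_le_iff₀ hη']
  exact h1

/-- THE COARSE GRADIENT LETTER OF THE BLOCK-MEAN FIELD: `‖Z′(y′) − Z′(y′ − e_μ)‖ ≤ η′g` on the fine torus ⟹ `‖Z̄(b) − Z̄(b − e_μ)‖ ≤ η·g` with `η = L·η′` (file 9
`norm_fdiffTV_blockMeanTV_le` at `b − e_μ`). [cite: Balaban1985BackgroundPropagators, (3.35) p.396 (shape)] -/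
theorem gradLetter_blockMean {η' g : ℝ} (hη' : 0 < η') (hg : 0 ≤ g) {a' : Tor (fine L M) → V} (μ : Fin d) (h : ∀ y', ‖a' y' - a' (y' - unitVec (fine L M) μ)‖ ≤ η' * g)
    (b : Tor M) : ‖blockMeanTV L M a' b - blockMeanTV L M a' (b - unitVec M μ)‖ ≤ (L : ℝ) * η' * g := by
  have hL : (0 : ℝ) < L := by exact_mod_cast Nat.pos_of_ne_zero (NeZero.ne L)
  have hη : 0 < (L : ℝ) * η' := mul_pos hL hη'
  have key := norm_fdiffTV_blockMeanTV_le L M μ (η := (L : ℝ) * η') (η' := η') rfl (a' := a') (b := b - unitVec M μ) hg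
    fun j k _ => quotient_le_of_gradLetter hη' μ h _
  rw [sub_add_cancel, norm_smul, norm_inv, Real.norm_eq_abs, abs_of_pos hη, inv_mul_le_iff₀ hη] at key
  exact key

end Prelim

/-! ## §2 The curved knit on King's torus pairing -/

section Knit

variable (L : ℕ) [NeZero L] (M : Fin d → ℕ) [hM : ∀ μ, NeZero (M μ)]
variable {ι : Type} [Fintype ι] [DecidableEq ι] {𝔄 : Type} [NormedRing 𝔄] [NormedAlgebra ℝ 𝔄] [CompleteSpace 𝔄] (e : 𝔄 ≃L[ℝ] (ι → ℝ))
variable {geo : B6.Geometry} (blk : Tor M → geo.Site) (η' : ℝ) (Z' W' : Fin d → Tor (fine L M) → (𝔄 →L[ℝ] 𝔄))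
variable (G : (Tor M × ι → ℝ) →ₗ[ℝ] (Tor M × ι → ℝ)) (G' : (Tor (fine L M) × ι → ℝ) →ₗ[ℝ] (Tor (fine L M) × ι → ℝ))

/-- ★★★ **THE CURVED KNIT ON KING's TORUS PAIRING.**  Fine torus `Tor (fine L M)` at spacing `η′ > 0`, coarse torus `Tor M` at `η = Lη′ ≤ η₀`, block map `blockOf L M`, unit translations
as steps; perturbation generators `Z′_μ` and background generators `W′_μ` on the fine torus, SKEW in the coordinates `e`, with the (3.35)∕(3.36)-SHAPED letters `‖Z′‖ ≤ r`, `‖W′‖ ≤ r_B`,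
`‖Z′_μ(y′) − Z′_μ(y′ − e_ν)‖ ≤ η′g`, `‖W′_μ(y′) − W′_μ(y′ − e_ν)‖ ≤ η′g_B` (every direction `ν`), `‖η′⁻¹(Z′_μ(z′ + e_ν + e_μ) − Z′_μ(z′ + e_ν)) − η′⁻¹(Z′_μ(z′ + e_μ) − Z′_μ(z′))‖ ≤ η′G₂`; coarse generators
`Z = blockMeanTV Z′`, `W = blockMeanTV W′`; regimes `η₀r ≤ 1`, `η₀r_B ≤ 1`; the [B6] carrier on `Tor M`, the (3.42)₀,₁-shaped block majorants `βe^{−δd}` of `G(U)`, `D^±_RG(U)` on both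
grids and their η-defects `≤ m e^{−δd}` (the inductive datum), `ρ + σ ≤ δ`, and the Neumann smallness at `expRowLetter`.  CONCLUSION: file 7's majorant for the η-defect of the
dressed pairs `X̂(e^{η′Z′}U′)` vs `X̂(e^{ηZ}U)`, at the DERIVED fits `o = dηg`, `o_t = dηg + ηg`, `o_W = dηg_B + ηg_B`, `o_D = (d+1)ηG₂`.
[cite: Balaban1985BackgroundPropagators, (3.35)–(3.37) p.396, (3.52)–(3.53) p.400, (3.63)–(3.65) pp.402–403 (shapes, mechanism)] -/
theorem hasMaj_idef_curvDressed_kingTorus (htri : Triangle254 geo) (hd : ∀ a b : geo.Site, 0 ≤ geo.dist a b) {σ cr : ℝ} (hσ : 0 ≤ σ) (hcr : 0 ≤ cr) (hrow : RowSum geo σ cr)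
    {ρ δ β m η₀ r rB g gB G₂ : ℝ} (hρ : 0 ≤ ρ) (hρδ : ρ + σ ≤ δ) (hβ : 0 ≤ β) (hm : 0 ≤ m)
    (hreg : η₀ * r ≤ 1) (hregB : η₀ * rB ≤ 1) (hη' : 0 < η') (hηη₀ : (L : ℝ) * η' ≤ η₀)
    (hr : 0 ≤ r) (hrB : 0 ≤ rB) (hg : 0 ≤ g) (hgB : 0 ≤ gB) (hG₂ : 0 ≤ G₂)
    -- the U-layer at the curved base point, both grids, and its η-defects (entries 0∕1 of NE2⁺ at U)
    (hG : HasMaj (BlockNorm.ofBlocks geo (liftBlk blk ι)) (BlockNorm.ofBlocks geo (liftBlk blk ι)) G (fun y y' => β * Real.exp (-(δ * geo.dist y y'))))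
    (hD : ∀ j, HasMaj (BlockNorm.ofBlocks geo (liftBlk blk ι)) (BlockNorm.ofBlocks geo (liftBlk blk ι))
      (covPieces ((L : ℝ) * η') (torStep M) (gaugePair (torStep M) (expTrField e ((L : ℝ) * η') (blockMeanField L M W'))) G j) (fun y y' => β * Real.exp (-(δ * geo.dist y y'))))
    (hG' : HasMaj (BlockNorm.ofBlocks geo (liftBlk (blk ∘ blockOf L M) ι)) (BlockNorm.ofBlocks geo (liftBlk (blk ∘ blockOf L M) ι)) G'
      (fun y y' => β * Real.exp (-(δ * geo.dist y y'))))
    (hD' : ∀ j, HasMaj (BlockNorm.ofBlocks geo (liftBlk (blk ∘ blockOf L M) ι)) (BlockNorm.ofBlocks geo (liftBlk (blk ∘ blockOf L M) ι))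
      (covPieces η' (torStep (fine L M)) (gaugePair (torStep (fine L M)) (expTrField e η' W')) G' j) (fun y y' => β * Real.exp (-(δ * geo.dist y y'))))
    (hDG : HasMaj (BlockNorm.ofBlocks geo (liftBlk blk ι)) (BlockNorm.ofBlocks geo (liftBlk (blk ∘ blockOf L M) ι))
      (idef (pull (liftMap (blockOf L M) ι)) (pull (liftMap (blockOf L M) ι)) G' G) (fun y y' => m * Real.exp (-(δ * geo.dist y y'))))
    (hDD : ∀ j, HasMaj (BlockNorm.ofBlocks geo (liftBlk blk ι)) (BlockNorm.ofBlocks geo (liftBlk (blk ∘ blockOf L M) ι))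
      (idef (pull (liftMap (blockOf L M) ι)) (pull (liftMap (blockOf L M) ι)) (covPieces η' (torStep (fine L M)) (gaugePair (torStep (fine L M)) (expTrField e η' W')) G' j)
        (covPieces ((L : ℝ) * η') (torStep M) (gaugePair (torStep M) (expTrField e ((L : ℝ) * η') (blockMeanField L M W'))) G j))
      (fun y y' => m * Real.exp (-(δ * geo.dist y y'))))
    -- (3.35)∕(3.36)-shaped letters on the FINE generator fields only
    (hZ' : ∀ μ y', ‖Z' μ y'‖ ≤ r) (hW' : ∀ μ y', ‖W' μ y'‖ ≤ rB)
    (hgrad' : ∀ μ ν y', ‖Z' μ y' - Z' μ (y' - unitVec (fine L M) ν)‖ ≤ η' * g) (hgradW' : ∀ μ ν y', ‖W' μ y' - W' μ (y' - unitVec (fine L M) ν)‖ ≤ η' * gB)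
    (hsec' : ∀ μ ν (z' : Tor (fine L M)), ‖η'⁻¹ • (Z' μ (z' + unitVec (fine L M) ν + unitVec (fine L M) μ) - Z' μ (z' + unitVec (fine L M) ν)) -
      η'⁻¹ • (Z' μ (z' + unitVec (fine L M) μ) - Z' μ z')‖ ≤ η' * G₂)
    (hZs' : ∀ μ y', (coordMat e (Z' μ y'))ᵀ = -coordMat e (Z' μ y')) (hWs' : ∀ μ y', (coordMat e (W' μ y'))ᵀ = -coordMat e (W' μ y'))
    -- the Neumann smallness at the generator-level row letter
    (hq : β * (expRowLetter ι (Fin d) (basisConst e) r rB g * (1 + Fintype.card (Fin d ⊕ Fin d))) * cr < 1) :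
    HasMaj (BlockNorm.ofBlocks geo (liftBlk blk ι)) (BlockNorm.ofBlocks geo (blkPair (liftBlk (blk ∘ blockOf L M) ι)))
      (idef (pull (liftMap (blockOf L M) ι)) (pull (liftPair (liftMap (blockOf L M) ι)))
        (curvDressed η' (torStep (fine L M)) (expTrField e η' W') (expTrField e η' Z') G')
        (curvDressed ((L : ℝ) * η') (torStep M) (expTrField e ((L : ℝ) * η') (blockMeanField L M W')) (expTrField e ((L : ℝ) * η') (blockMeanField L M Z')) G))
      (fun y y' => (m * cr + 1 * (m * cr) * (expRowLetter ι (Fin d) (basisConst e) r rB g * (1 + Fintype.card (Fin d ⊕ Fin d)) *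
          (β * (1 - β * (expRowLetter ι (Fin d) (basisConst e) r rB g * (1 + Fintype.card (Fin d ⊕ Fin d))) * cr)⁻¹)) +
          β * (expFitLetter ι (Fin d) (basisConst e) r rB g ((d : ℝ) * ((L : ℝ) * η') * g) ((d : ℝ) * ((L : ℝ) * η') * g + (L : ℝ) * η' * g)
              ((d : ℝ) * ((L : ℝ) * η') * gB + (L : ℝ) * η' * gB) (((d : ℝ) + 1) * ((L : ℝ) * η') * G₂) ((L : ℝ) * η') * (1 + Fintype.card (Fin d ⊕ Fin d))) *
            (β * (1 - β * (expRowLetter ι (Fin d) (basisConst e) r rB g * (1 + Fintype.card (Fin d ⊕ Fin d))) * cr)⁻¹) * cr) *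
        (1 - 1 * (β * (expRowLetter ι (Fin d) (basisConst e) r rB g * (1 + Fintype.card (Fin d ⊕ Fin d))) * cr))⁻¹ * Real.exp (-(ρ * geo.dist y y'))) := by
  have hL1 : (1 : ℝ) ≤ L := by exact_mod_cast Nat.pos_of_ne_zero (NeZero.ne L)
  have hη'η : η' ≤ (L : ℝ) * η' := le_mul_of_one_le_left hη'.le hL1
  have hLη : (L : ℝ) * η' = (L : ℝ) * η' := rfl
  -- the derived generator-level data of the knit
  have hZ : ∀ μ b, ‖blockMeanField L M Z' μ b‖ ≤ r := fun μ b => norm_blockMeanTV_le L M hr fun j => hZ' μ _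
  have hW : ∀ μ b, ‖blockMeanField L M W' μ b‖ ≤ rB := fun μ b => norm_blockMeanTV_le L M hrB fun j => hW' μ _
  have hgrad : ∀ μ b, ‖blockMeanField L M Z' μ b - blockMeanField L M Z' μ ((torStep M μ).symm b)‖ ≤ (L : ℝ) * η' * g := fun μ b => by
    rw [torStep_symm_apply]; exact gradLetter_blockMean L M hη' hg μ (hgrad' μ μ) b
  have hgradW : ∀ μ b, ‖blockMeanField L M W' μ b - blockMeanField L M W' μ ((torStep M μ).symm b)‖ ≤ (L : ℝ) * η' * gB := fun μ b => by
    rw [torStep_symm_apply]; exact gradLetter_blockMean L M hη' hgB μ (hgradW' μ μ) b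
  have hfit : ∀ μ y', ‖Z' μ y' - blockMeanField L M Z' μ (blockOf L M y')‖ ≤ (d : ℝ) * ((L : ℝ) * η') * g := fun μ y' =>
    (fit_blockMeanTV L M (a' := Z' μ) (θ₁ := fun _ => η' * g) (fun _ => mul_nonneg hη'.le hg)
      (fun y ν _ => by have h1 := hgrad' μ ν (y + unitVec (fine L M) ν); rwa [add_sub_cancel_right] at h1) y').trans (coeff_osc_rate d L hη'.le hg rfl hLη)
  have hfitWp : ∀ μ y', ‖W' μ y' - blockMeanField L M W' μ (blockOf L M y')‖ ≤ (d : ℝ) * ((L : ℝ) * η') * gB := fun μ y' =>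
    (fit_blockMeanTV L M (a' := W' μ) (θ₁ := fun _ => η' * gB) (fun _ => mul_nonneg hη'.le hgB)
      (fun y ν _ => by have h1 := hgradW' μ ν (y + unitVec (fine L M) ν); rwa [add_sub_cancel_right] at h1) y').trans (coeff_osc_rate d L hη'.le hgB rfl hLη)
  have hcompat : ∀ μ y', blockOf L M ((torStep (fine L M) μ).symm y') = blockOf L M y' ∨
      blockOf L M ((torStep (fine L M) μ).symm y') = (torStep M μ).symm (blockOf L M y') := fun μ y' => blockOf_compat_addRight L M μ y'
  have hfitT : ∀ μ y', ‖Z' μ ((torStep (fine L M) μ).symm y') - blockMeanField L M Z' μ ((torStep M μ).symm (blockOf L M y'))‖ ≤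
      (d : ℝ) * ((L : ℝ) * η') * g + (L : ℝ) * η' * g :=
    fitTranslated_of_fit_of_compat (torStep M) (torStep (fine L M)) (blockOf L M) hcompat hfit hgrad
  have hfitW : ∀ μ y', ‖W' μ ((torStep (fine L M) μ).symm y') - blockMeanField L M W' μ ((torStep M μ).symm (blockOf L M y'))‖ ≤
      (d : ℝ) * ((L : ℝ) * η') * gB + (L : ℝ) * η' * gB :=
    fitTranslated_of_fit_of_compat (torStep M) (torStep (fine L M)) (blockOf L M) hcompat hfitWp hgradW
  have hfitD : ∀ μ y', ‖η'⁻¹ • (Z' μ y' - Z' μ ((torStep (fine L M) μ).symm y')) -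
      ((L : ℝ) * η')⁻¹ • (blockMeanField L M Z' μ (blockOf L M y') - blockMeanField L M Z' μ ((torStep M μ).symm (blockOf L M y')))‖ ≤ ((d : ℝ) + 1) * ((L : ℝ) * η') * G₂ :=
    fun μ y' => by
    rw [torStep_symm_apply, torStep_symm_apply]
    exact (fit_bdiffTV_blockMeanTV L M μ hLη (a' := Z' μ) (θ₂ := fun _ => η' * G₂) (fun _ => mul_nonneg hη'.le hG₂) (fun b z' _ ν => hsec' μ ν z') y').trans
      (species2_rate d L hη'.le hG₂ hLη)
  have hZs : ∀ μ b, (coordMat e (blockMeanField L M Z' μ b))ᵀ = -coordMat e (blockMeanField L M Z' μ b) := fun μ b => blockMeanTV_skew L M e (hZs' μ) b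
  have hWs : ∀ μ b, (coordMat e (blockMeanField L M W' μ b))ᵀ = -coordMat e (blockMeanField L M W' μ b) := fun μ b => blockMeanTV_skew L M e (hWs' μ) b
  have hgrad'' : ∀ μ y', ‖Z' μ y' - Z' μ ((torStep (fine L M) μ).symm y')‖ ≤ η' * g := fun μ y' => by rw [torStep_symm_apply]; exact hgrad' μ μ y'
  exact hasMaj_idef_curvDressed_exp_of_skew e blk (blockOf L M) ((L : ℝ) * η') η' (torStep M) (torStep (fine L M)) (blockMeanField L M Z') (blockMeanField L M W') Z' W' G G'
    htri hd hσ hcr hrow hρ hρδ hβ hm hreg hregB hη' hη'η hηη₀ hr hrB hg (by positivity) (by positivity) (by positivity) (by positivity) hG hD hG' hD' hDG hDD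
    hZ hZ' hW hW' hgrad hgrad'' hfit hfitT hfitW hfitD hZs hWs hZs' hWs' hq

end Knit

end Summit.QuantumFields.YangMills.BalabanUVNodes.N15.CurvedSpecies

end
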